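import Summits.BirchSwinnertonDyer.BirchSwinnertonDyer.Theorems.Rank2Observatory2DescClCurveCert
import Summits.BirchSwinnertonDyer.BirchSwinnertonDyer.Theorems.Rank2Observatory2DescClFamCertQ2Logs
import HarnessLib

/-!
# BirchSwinnertonDyer — rank ≥ 2 observatory: KERNEL-2DESC-CL Q2 — the per-curve certificate over a two-prime field record and `rank E(ℚ) = 2`, part 3

HONEST FRAMING: per-curve certified theorems and census instruments; no claim on BSD in rank ≥ 2.

Part 3 of the two-auxiliary-prime variant (parts 1–2: `Rank2Observatory2DescClFieldCertQ2[Sound]`,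
`Rank2Observatory2DescClFamCertQ2[Logs]`).  The per-curve record `ClCurveCertQ2` is `ClCurveCert` with FOUR
inverse certificates `D ∉ W₁₁, W₁₂, W₂₁, W₂₂`; the family is `−1, ε, γ₁, γ₂, q₁, q₂` and the `g_P`
(`P ∈ codes ⊆ supp D`) — `|supp(D·q₁q₂)| + rank 𝓞ˣ + 1` elements; the parity matrix has rows real sign,
the parities of `ord` at the four auxiliary primes, and the Euler bits of the residue characters; the sieve is
the norm-square-residue test plus the four valuation rows.  Soundness (`rank_le_two_of_check_cl₂`) is the
v2.0 proof (`Rank2Observatory2DescClCurveCert`) over the generic cover-set theorem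
`mordellWeilRank_le_of_coverSet_cl` with modulus `M = D·q₁q₂` and the generation theorem
`closure_q2_eq_top_of_check` — the class group may be ANY finite abelian group generated by the classes of
`W₁₁`, `W₂₁` (the non-cyclic census fields, `generics/q2/Q2-SPEC.md`).  `K`-free wrappers
`rank_eq_two_of_certs₂`, `rank_eq_two_of_certs_complSq₂` are the shape of every sharded row.

Sorry-free; new declarations only; axioms `propext`, `Classical.choice`, `Quot.sound`.
[cite: Cassels1991LecturesEllipticCurves, §15] [cite: Cohen1993, §6.5] [cite: CremonaAlgorithms1997, §3.6]
-/

set_option linter.dupNamespace false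

noncomputable section

open scoped Classical NumberField nonZeroDivisors

open Literature.NumberTheory.NumberFields Polynomial Module NumberField IsDedekindDomain Ideal

namespace Summit.BirchSwinnertonDyer.BirchSwinnertonDyer.Rank2Observatory.TwoDescCl

open TwoDescCubic ClFieldCertQ2

/-! ## The record and the computable checker -/

/-- The per-curve certificate over a two-prime field record (see the module docstring). -/
structure ClCurveCertQ2 where
  /-- `y² = x³ + Ax² + Bx + C` -/
  A : ℤ
  /-- `y² = x³ + Ax² + Bx + C` -/
  B : ℤ
  /-- `y² = x³ + Ax² + Bx + C` -/
  C : ℤ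
  /-- a modulus modulo which `F` has no root -/
  pF : ℕ
  /-- `θ_E = t₀ + t₁α + t₂α²`, a root of `F` in `𝓞 K` -/
  t : ℤ × ℤ × ℤ
  /-- `D = F′(θ_E)` on the power basis -/
  D : ℤ × ℤ × ℤ
  /-- `|N(D)| = ∏ p^e` -/
  dn : List (ℕ × ℕ)
  /-- the codes of the primes `P ∋ D` used in the family (each has a registry element `g_P`) -/
  codes : List PCode
  /-- inverse certificates `D ∉ P` for the remaining codes above the primes of `dn` -/
  dinv : List (PCode × (ℤ × ℤ × ℤ))
  /-- inverse certificate `D ∉ W₁₁` -/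
  dW11 : ℤ × ℤ × ℤ
  /-- inverse certificate `D ∉ W₁₂` -/
  dW12 : ℤ × ℤ × ℤ
  /-- inverse certificate `D ∉ W₂₁` -/
  dW21 : ℤ × ℤ × ℤ
  /-- inverse certificate `D ∉ W₂₂` -/
  dW22 : ℤ × ℤ × ℤ
  /-- sieve moduli for the norm-square-residue test -/
  Q : List ℕ

/-- The registry element of the code `C` (junk if absent). -/
def ClFieldCertQ2.elemOf (fc : ClFieldCertQ2) (C : PCode) : ElemEntry :=
  ((fc.row C.1).els.find? fun el => el.code == C.2).getD noEntry

/-- **The `T`-unit family of the curve**: `−1, ε, γ₁, γ₂, q₁, q₂` and the `g_P`, `P ∈ codes`. -/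
def fam₂ (fc : ClFieldCertQ2) (cc : ClCurveCertQ2) : List FamEntry :=
  (0, ((0 : ℕ), (0 : ℤ), (0 : ℤ), (0 : ℤ)), negOneEntry) :: (0, ((0 : ℕ), (0 : ℤ), (0 : ℤ), (0 : ℤ)), fc.fu) ::
    (3, ((0 : ℕ), (0 : ℤ), (0 : ℤ), (0 : ℤ)), fc.gam₁) :: (3, ((0 : ℕ), (0 : ℤ), (0 : ℤ), (0 : ℤ)), fc.gam₂) ::
    (1, ((0 : ℕ), (0 : ℤ), (0 : ℤ), (0 : ℤ)), qEntryElem fc.q₁) :: (4, ((0 : ℕ), (0 : ℤ), (0 : ℤ), (0 : ℤ)), qEntryElem fc.q₂) ::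
    cc.codes.map fun C => (2, C, fc.elemOf C)

/-- Row `k` of the parity matrix at the entry `f`: `0` real sign, `1 … 4` parity of `ord` at `W₁₁, W₁₂, W₂₁,
W₂₂`, `5 + i` the Euler bit of the `i`-th residue character. -/
def bitRow₂ (fc : ClFieldCertQ2) (f : FamEntry) : ℕ → Bool
  | 0 => f.2.2.sg
  | 1 => !decide ((2 : ℤ) ∣ famL₁₁ f)
  | 2 => !decide ((2 : ℤ) ∣ famL₁₂ f)
  | 3 => !decide ((2 : ℤ) ∣ famL₂₁ f)
  | 4 => !decide ((2 : ℤ) ∣ famL₂₂ f)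
  | k + 5 => eulerBit (fc.chars.getD k (3, 0, 0)).1 (evalInt (fc.chars.getD k (3, 0, 0)).2.1 f.2.2.g)

/-- The parity matrix of the family. -/
def bit₂ (fc : ClFieldCertQ2) (cc : ClCurveCertQ2) (k : Fin (fc.chars.length + 5)) (j : Fin (fam₂ fc cc).length) :
    Bool :=
  bitRow₂ fc ((fam₂ fc cc).get j) k
/-- The norms of the family. -/
def famNorm₂ (fc : ClFieldCertQ2) (cc : ClCurveCertQ2) (j : Fin (fam₂ fc cc).length) : ℤ :=
  normFormZ fc.a fc.b fc.c ((fam₂ fc cc).get j).2.2.g.1 ((fam₂ fc cc).get j).2.2.g.2.1 ((fam₂ fc cc).get j).2.2.g.2.2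
/-- The sign bits of the family. -/
def famSign₂ (fc : ClFieldCertQ2) (cc : ClCurveCertQ2) (j : Fin (fam₂ fc cc).length) : Bool :=
  ((fam₂ fc cc).get j).2.2.sg
/-- **The sieve** on pairs `(T, U)` (`T = ∅`): norm-square residues modulo `Q`, sign, parities of `ord` at the
four auxiliary primes. -/
def adm₂ (fc : ClFieldCertQ2) (cc : ClCurveCertQ2) (T : Finset (Fin 0)) (U : Finset (Fin (fam₂ fc cc).length)) :
    Bool :=
  admStdQ cc.Q (fun i : Fin 0 => i.elim0) (famNorm₂ fc cc) (fun i : Fin 0 => i.elim0) (famSign₂ fc cc) T U &&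
    decide (Even (U.filter fun j => bitRow₂ fc ((fam₂ fc cc).get j) 1 = true).card) &&
    decide (Even (U.filter fun j => bitRow₂ fc ((fam₂ fc cc).get j) 2 = true).card) &&
    decide (Even (U.filter fun j => bitRow₂ fc ((fam₂ fc cc).get j) 3 = true).card) &&
    decide (Even (U.filter fun j => bitRow₂ fc ((fam₂ fc cc).get j) 4 = true).card)
/-- **The per-curve checker (two auxiliary primes).** Computable; run by `decide +kernel`.
[cite: Cassels1991LecturesEllipticCurves, §15] -/
def check₂ (fc : ClFieldCertQ2) (cc : ClCurveCertQ2) : Bool :=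
  decide (deltaShort cc.A cc.B cc.C ≠ 0) &&
    noRootMod cc.pF cc.A cc.B cc.C &&
    decide (cubicAtCoords fc.a fc.b fc.c cc.A cc.B cc.C cc.t = (0, 0, 0)) &&
    decide (derivAtCoords fc.a fc.b fc.c cc.A cc.B cc.t =
      MonicCubic.mulCoords fc.a fc.b fc.c cc.D (prodPowCoords fc.a fc.b fc.c [])) &&
    decide (MonicCubic.disc cc.A cc.B cc.C < 0) &&
    decide (normFormZ fc.a fc.b fc.c cc.D.1 cc.D.2.1 cc.D.2.2 ≠ 0) &&
    decide ((normFormZ fc.a fc.b fc.c cc.D.1 cc.D.2.1 cc.D.2.2).natAbs = (cc.dn.map fun pe => pe.1 ^ pe.2).prod) &&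
    (cc.dn.all fun pe => (fc.primes.any fun e => e.p == pe.1) &&
      ((fc.row pe.1).codes.all fun C' => decide (C' ∈ cc.codes) ||
        cc.dinv.any fun ci => ci.1 == C' && invCert fc.a fc.b fc.c C' cc.D ci.2)) &&
    (cc.codes.all fun C => (fc.primes.any fun e => e.p == C.1) && decide (C ∈ (fc.row C.1).codes)) &&
    invCert fc.a fc.b fc.c fc.w₁₁ cc.D cc.dW11 && invCert fc.a fc.b fc.c fc.w₁₂ cc.D cc.dW12 &&
    invCert fc.a fc.b fc.c fc.w₂₁ cc.D cc.dW21 && invCert fc.a fc.b fc.c fc.w₂₂ cc.D cc.dW22 &&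
    (cc.Q.all fun q => decide (0 < q)) &&
    ((fam₂ fc cc).all fun f => famCheck₂ fc cc.D f) &&
    decide (∀ T : Finset (Fin (fam₂ fc cc).length), T ≠ ∅ →
      ∃ k : Fin (fc.chars.length + 5), Odd (T.filter fun j => bit₂ fc cc k j = true).card) &&
    decide (((Finset.univ ×ˢ Finset.univ).filter
      (fun p : Finset (Fin 0) × Finset (Fin (fam₂ fc cc).length) => adm₂ fc cc p.1 p.2 = true)).card ≤ 2 ^ 2)

/-! ## The prime of a certified code -/
namespace ClFieldCertQ2
variable {K : Type*} [Field K] [NumberField K] {θ : K} {fc : ClFieldCertQ2}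
/-- The height-one prime `idealOf C` of a code certified present in the registry (junk `W₁₁` otherwise). -/
def codePrime (hθ : aeval θ (MonicCubic.poly fc.a fc.b fc.c) = 0) (h3 : finrank ℚ K = 3) (hF : fc.check = true)
    (hpr : fc.primeList.Forall Nat.Prime) (C : PCode) : HeightOneSpectrum (𝓞 K) :=
  if h : (fc.primes.any fun e => e.p == C.1) = true ∧ C ∈ (fc.row C.1).codes then
    primeOfCode (fc.irreducible_of_check hF) hθ h3 (e := fc.row C.1) (fc.prime_of_mem hpr (row_mem h.1).1)
      (fc.row_check_of_mem hF (row_mem h.1).1).1 h.2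
  else fc.W₁₁ hθ h3 hF hpr
/-- A certified code prime is presented by its code. [folklore] -/
theorem codePrime_asIdeal {fc : ClFieldCertQ2} (hθ : aeval θ (MonicCubic.poly fc.a fc.b fc.c) = 0) (h3 : finrank ℚ K = 3)
    (hF : fc.check = true) (hpr : fc.primeList.Forall Nat.Prime) {C : PCode}
    (h₁ : (fc.primes.any fun e => e.p == C.1) = true) (h₂ : C ∈ (fc.row C.1).codes) :
    (codePrime hθ h3 hF hpr C).asIdeal = idealOf hθ C := by
  rw [codePrime, dif_pos ⟨h₁, h₂⟩]
  rfl
end ClFieldCertQ2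

/-! ## Soundness -/
section Sound
variable {K : Type*} [Field K] [NumberField K] {θ : K}
/-- **Soundness of the per-curve checker: `rank E(ℚ) ≤ 2`.** [cite: Cassels1991LecturesEllipticCurves, §15] -/
theorem rank_le_two_of_check_cl₂ (fc : ClFieldCertQ2) (hθ : aeval θ (MonicCubic.poly fc.a fc.b fc.c) = 0)
    (h3 : finrank ℚ K = 3) (hF : fc.check = true) (hpr : fc.primeList.Forall Nat.Prime) (cc : ClCurveCertQ2)
    (hc : check₂ fc cc = true) : ((⟨0, cc.A, 0, cc.B, cc.C⟩ : WeierstrassCurve ℚ)).mordellWeilRank ≤ 2 := by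
  classical
  have hirr := fc.irreducible_of_check hF
  have hq₁ := fc.q₁_prime hpr
  have hq₂ := fc.q₂_prime hpr
  simp only [check₂, Bool.and_eq_true, decide_eq_true_eq, List.all_eq_true, List.any_eq_true,
    Bool.or_eq_true, beq_iff_eq] at hc
  obtain ⟨⟨⟨⟨⟨⟨⟨⟨⟨⟨⟨⟨⟨⟨⟨⟨hΔ, hirrF⟩, hcub⟩, hder⟩, hdisc⟩, hND0⟩, hdn⟩, hdnC⟩, hcodes⟩, hdW11⟩, hdW12⟩,
    hdW21⟩, hdW22⟩, hQ⟩, hfamAll⟩, hcert⟩, hcount⟩ := hc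
  haveI hE := isElliptic_of_deltaShort_ne hΔ
  have hirrF' := irreducible_of_noRootMod hirrF
  -- `θ_E`, `D`, `M = D·q₁q₂`
  have haev := aeval_lin_eq_zero_of_coords hθ cc.t hcub
  have hderiv : (3 : 𝓞 K) * (lin hθ cc.t.1 cc.t.2.1 cc.t.2.2) ^ 2 +
      2 * ((cc.A : ℤ) : 𝓞 K) * (lin hθ cc.t.1 cc.t.2.1 cc.t.2.2) + ((cc.B : ℤ) : 𝓞 K) =
        lin hθ cc.D.1 cc.D.2.1 cc.D.2.2 := by
    simpa using deriv_eq_of_coords hθ cc.t cc.D [] hder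
  have hD0 : (lin hθ cc.D.1 cc.D.2.1 cc.D.2.2 : 𝓞 K) ≠ 0 := lin_ne_zero_of_coords hirr hθ h3 _ hND0
  have hq0 : ((fc.q₁ * fc.q₂ : ℕ) : 𝓞 K) ≠ 0 := by exact_mod_cast (Nat.mul_ne_zero hq₁.ne_zero hq₂.ne_zero)
  have hM0 : (lin hθ cc.D.1 cc.D.2.1 cc.D.2.2 : 𝓞 K) * ((fc.q₁ * fc.q₂ : ℕ) : 𝓞 K) ≠ 0 := mul_ne_zero hD0 hq0
  have hgen := closure_tsupp_eq_top_of_dvd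
    (dvd_mul_left ((fc.q₁ * fc.q₂ : ℕ) : 𝓞 K) (lin hθ cc.D.1 cc.D.2.1 cc.D.2.2))
    (fc.closure_q2_eq_top_of_check hθ h3 hF hpr)
  have hDM : ∀ v : HeightOneSpectrum (𝓞 K), (3 : 𝓞 K) * (lin hθ cc.t.1 cc.t.2.1 cc.t.2.2) ^ 2 +
      2 * ((cc.A : ℤ) : 𝓞 K) * (lin hθ cc.t.1 cc.t.2.1 cc.t.2.2) + ((cc.B : ℤ) : 𝓞 K) ∈ v.asIdeal →
      (lin hθ cc.D.1 cc.D.2.1 cc.D.2.2 : 𝓞 K) * ((fc.q₁ * fc.q₂ : ℕ) : 𝓞 K) ∈ v.asIdeal := by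
    intro v hv
    rw [hderiv] at hv
    exact Ideal.mul_mem_right _ _ hv
  have hDW₁₁ : (lin hθ cc.D.1 cc.D.2.1 cc.D.2.2 : 𝓞 K) ∉ (fc.W₁₁ hθ h3 hF hpr).asIdeal :=
    lin_not_mem_of_invCert hθ _ (W₁₁_asIdeal hθ h3 hF hpr) hdW11
  have hDW₁₂ : (lin hθ cc.D.1 cc.D.2.1 cc.D.2.2 : 𝓞 K) ∉ (fc.W₁₂ hθ h3 hF hpr).asIdeal :=
    lin_not_mem_of_invCert hθ _ (W₁₂_asIdeal hθ h3 hF hpr) hdW12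
  have hDW₂₁ : (lin hθ cc.D.1 cc.D.2.1 cc.D.2.2 : 𝓞 K) ∉ (fc.W₂₁ hθ h3 hF hpr).asIdeal :=
    lin_not_mem_of_invCert hθ _ (W₂₁_asIdeal hθ h3 hF hpr) hdW21
  have hDW₂₂ : (lin hθ cc.D.1 cc.D.2.1 cc.D.2.2 : 𝓞 K) ∉ (fc.W₂₂ hθ h3 hF hpr).asIdeal :=
    lin_not_mem_of_invCert hθ _ (W₂₂_asIdeal hθ h3 hF hpr) hdW22
  -- the support `T = {W₁₁, W₁₂, W₂₁, W₂₂} ∪ codes`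
  set L := cc.codes.length with hL
  let Tf : Fin (L + 4) → HeightOneSpectrum (𝓞 K) := Matrix.vecCons (fc.W₁₁ hθ h3 hF hpr)
    (Matrix.vecCons (fc.W₁₂ hθ h3 hF hpr) (Matrix.vecCons (fc.W₂₁ hθ h3 hF hpr)
      (Matrix.vecCons (fc.W₂₂ hθ h3 hF hpr) fun i => codePrime hθ h3 hF hpr (cc.codes.get i))))
  have hT : ∀ w : HeightOneSpectrum (𝓞 K),
      (lin hθ cc.D.1 cc.D.2.1 cc.D.2.2 : 𝓞 K) * ((fc.q₁ * fc.q₂ : ℕ) : 𝓞 K) ∈ w.asIdeal → ∃ i, Tf i = w := by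
    intro w hw
    rcases w.isPrime.mem_or_mem hw with hD | hqw
    · obtain ⟨l, hl, hldvd, hlw⟩ := exists_prime_dvd_norm_mem w hD0 hD
      rw [natAbs_norm_lin_coords hirr hθ h3, hdn] at hldvd
      obtain ⟨a, ha, hla⟩ := (Prime.dvd_prod_iff hl.prime).mp hldvd
      obtain ⟨pe, hpe, rfl⟩ := List.mem_map.mp ha
      obtain ⟨hany, hrowcodes⟩ := hdnC pe hpe
      have hany' : (fc.primes.any fun e => e.p == pe.1) = true := by simpa [List.any_eq_true] using hany
      obtain ⟨hrow, hrowp⟩ := row_mem hany'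
      have hpp : (fc.row pe.1).p.Prime := fc.prime_of_mem hpr hrow
      have hl_eq : l = pe.1 :=
        (Nat.prime_dvd_prime_iff_eq hl (hrowp ▸ hpp)).mp (hl.dvd_of_dvd_pow hla)
      have hlw' : ((fc.row pe.1).p : 𝓞 K) ∈ w.asIdeal := by rw [hrowp, ← hl_eq]; exact hlw
      obtain ⟨C', hC', hw'⟩ :=
        exists_code_of_natCast_mem hirr hθ h3 hpp (fc.row_check_of_mem hF hrow).1 w hlw'
      rcases hrowcodes C' hC' with hmem | ⟨ci, -, hci, hinv⟩
      · obtain ⟨i, hi⟩ := List.mem_iff_get.mp hmem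
        obtain ⟨hc1, hc2⟩ := hcodes _ (List.get_mem _ i)
        have hc1' : (fc.primes.any fun e => e.p == (cc.codes.get i).1) = true := by
          simpa [List.any_eq_true] using hc1
        refine ⟨i.succ.succ.succ.succ, HeightOneSpectrum.ext ?_⟩
        simp only [Tf, Matrix.cons_val_succ]
        rw [codePrime_asIdeal hθ h3 hF hpr hc1' hc2, hi, hw']
      · exact absurd hD (lin_not_mem_of_invCert hθ w hw' hinv)
    · rw [natCast_q₁q₂] at hqw
      rcases w.isPrime.mem_or_mem hqw with h₁ | h₂
      · rcases eq_W₁₁_or_W₁₂ hθ h3 hF hpr w h₁ with rfl | rfl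
        · exact ⟨0, by simp [Tf]⟩
        · exact ⟨1, by simp [Tf]⟩
      · rcases eq_W₂₁_or_W₂₂ hθ h3 hF hpr w h₂ with rfl | rfl
        · exact ⟨2, by simp [Tf]⟩
        · exact ⟨3, by simp [Tf]⟩
  -- the family
  set fm := fam₂ fc cc with hfm
  let W : Fin fm.length → 𝓞 K := fun j => lin hθ (fm.get j).2.2.g.1 (fm.get j).2.2.g.2.1 (fm.get j).2.2.g.2.2
  have hfam : ∀ j : Fin fm.length, famCheck₂ fc cc.D (fm.get j) = true := fun j => hfamAll _ (List.get_mem _ j)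
  have hW0 : ∀ j, W j ≠ 0 := fun j => lin_ne_zero_of_famCheck₂ hθ h3 hF (hfam j)
  have hWval : ∀ j (v : HeightOneSpectrum (𝓞 K)),
      (lin hθ cc.D.1 cc.D.2.1 cc.D.2.2 : 𝓞 K) * ((fc.q₁ * fc.q₂ : ℕ) : 𝓞 K) ∉ v.asIdeal →
        v.valuation K (algebraMap (𝓞 K) K (W j)) = 1 :=
    fun j v hv => valuation_eq_one_of_support _ _ (supp_of_famCheck₂ hθ h3 hF hpr (hfam j)) v hv
  obtain ⟨ρ, hlo, hhi⟩ := fc.exists_rho_of_check hθ h3 hF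
  -- independence modulo squares: the parity certificate
  have hind : ∀ S : Finset (Fin fm.length), IsSquare (∏ i ∈ S, algebraMap (𝓞 K) K (W i)) → S = ∅ := by
    intro S hS
    refine indep_of_parity_certificate (fun i => algebraMap (𝓞 K) K (W i)) (bit₂ fc cc) ?_ hcert S hS
    intro k S' hS'
    have hS'' : IsSquare (∏ i ∈ S', W i) := isSquare_prod_of_isSquare_prod_coe _ hS'
    obtain ⟨k, hk⟩ := k
    rcases k with _ | _ | _ | _ | _ | k
    · have h := even_card_of_isSquare_real ρ (fun i => algebraMap (𝓞 K) K (W i))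
        (fun i => rho_ne_zero_of_famCheck₂ hθ ρ hlo hhi hF (hfam i)) hS'
      convert h using 2
      refine Finset.filter_congr (fun i _ => ?_)
      exact sign_iff_of_famCheck₂ hθ ρ hlo hhi hF (hfam i)
    · exact even_card_of_isSquare_valuation (fc.W₁₁ hθ h3 hF hpr) W hW0 _
        (fun i => by
          show ((!decide ((2 : ℤ) ∣ famL₁₁ (fm.get i))) = true ↔ _)
          rw [log_W₁₁_of_famCheck₂ hθ h3 hF hpr (hfam i)]; simp) hS'
    · exact even_card_of_isSquare_valuation (fc.W₁₂ hθ h3 hF hpr) W hW0 _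
        (fun i => by
          show ((!decide ((2 : ℤ) ∣ famL₁₂ (fm.get i))) = true ↔ _)
          rw [log_W₁₂_of_famCheck₂ hθ h3 hF hpr (hfam i)]; simp) hS'
    · exact even_card_of_isSquare_valuation (fc.W₂₁ hθ h3 hF hpr) W hW0 _
        (fun i => by
          show ((!decide ((2 : ℤ) ∣ famL₂₁ (fm.get i))) = true ↔ _)
          rw [log_W₂₁_of_famCheck₂ hθ h3 hF hpr (hfam i)]; simp) hS'
    · exact even_card_of_isSquare_valuation (fc.W₂₂ hθ h3 hF hpr) W hW0 _
        (fun i => by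
          show ((!decide ((2 : ℤ) ∣ famL₂₂ (fm.get i))) = true ↔ _)
          rw [log_W₂₂_of_famCheck₂ hθ h3 hF hpr (hfam i)]; simp) hS'
    · have hk' : k < fc.chars.length := by omega
      have hch : fc.chars.getD k ((3 : ℕ), (0 : ℤ), (0 : ℤ)) ∈ fc.chars := by
        rw [List.getD_eq_getElem?_getD, List.getElem?_eq_getElem hk', Option.getD_some]
        exact List.getElem_mem hk'
      obtain ⟨h2, ψ, hψ⟩ := fc.exists_psi_of_check hθ h3 hF hpr hch
      haveI : Fact (fc.chars.getD k (3, 0, 0)).1.Prime := ⟨fc.char_prime hpr hch⟩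
      have h := even_card_filter_eulerBit hθ (ℓ := (fc.chars.getD k (3, 0, 0)).1) (by omega) ψ hψ
        (fun i => (fm.get i).2.2.g) (fun i => not_dvd_evalInt_of_famCheck₂ (hfam i) hch) hS''
      convert h using 2
      exact Finset.filter_congr (fun i _ => Iff.rfl)
  -- spanning of the `T`-units modulo squares
  have hodd : Odd (finrank ℚ K) := by rw [h3]; decide
  have hn : fm.length = NumberField.Units.rank K + 1 + (L + 4) := by
    rw [fc.units_rank_of_check hθ h3 hF]
    simp only [hfm, fam₂, List.length_cons, List.length_map, hL]
    omega
  have hspan : ∀ u : K, u ≠ 0 →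
      (∀ v : HeightOneSpectrum (𝓞 K),
        (lin hθ cc.D.1 cc.D.2.1 cc.D.2.2 : 𝓞 K) * ((fc.q₁ * fc.q₂ : ℕ) : 𝓞 K) ∉ v.asIdeal → v.valuation K u = 1) →
      ∃ U : Finset (Fin fm.length), IsSquare (u * ∏ j ∈ U, algebraMap (𝓞 K) K (W j)) :=
    fun u hu huT => exists_isSquare_tunit_mul_prod hodd _ Tf hT hn (fun j => algebraMap (𝓞 K) K (W j))
      (fun j => RingOfIntegers.coe_ne_zero_iff.mpr (hW0 j)) hWval hind u hu huT
  -- the sieve is sound at rational points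
  have hθQ : ∀ x : ℚ, algebraMap ℚ K x ≠ algebraMap (𝓞 K) K (lin hθ cc.t.1 cc.t.2.1 cc.t.2.2) :=
    ne_of_powIndep (powIndep_algebraMap hirrF' haev h3)
  have hFrel : (lin hθ cc.t.1 cc.t.2.1 cc.t.2.2 : 𝓞 K) ^ 3 + cc.A * (lin hθ cc.t.1 cc.t.2.1 cc.t.2.2) ^ 2 +
      cc.B * (lin hθ cc.t.1 cc.t.2.1 cc.t.2.2) + cc.C = 0 := by
    apply RingOfIntegers.coe_injective
    simpa only [map_add, map_mul, map_pow, map_intCast, _root_.map_zero] using MonicCubic.theta_rel haev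
  have hadm0 : adm₂ fc cc ∅ ∅ = true := by
    simp only [adm₂, Bool.and_eq_true, decide_eq_true_eq, Finset.filter_empty, Finset.card_empty]
    exact ⟨⟨⟨⟨admStdQ_empty _ hQ _ _ _ _, by decide⟩, by decide⟩, by decide⟩, by decide⟩
  have hadm : ∀ x y : ℚ, y ^ 2 = x ^ 3 + cc.A * x ^ 2 + cc.B * x + cc.C →
      ∀ (T : Finset (Fin 0)) (U : Finset (Fin fm.length)),
        IsSquare ((algebraMap ℚ K x - algebraMap (𝓞 K) K (lin hθ cc.t.1 cc.t.2.1 cc.t.2.2)) *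
          (∏ i ∈ T, algebraMap (𝓞 K) K (((fun i : Fin 0 => i.elim0 : Fin 0 → (𝓞 K)ˣ) i : (𝓞 K)ˣ) : 𝓞 K)) *
            ∏ j ∈ U, algebraMap (𝓞 K) K (W j)) → adm₂ fc cc T U = true := by
    intro x y hxy T U hsq
    have hcof := cofactor_pos_of_disc_neg (rho_theta_root ρ haev) hdisc
    have h1 : admStd (fun i : Fin 0 => i.elim0) (famNorm₂ fc cc) (fun i : Fin 0 => i.elim0) (famSign₂ fc cc) T U =
        true :=
      admStd_sound hirrF' haev h3 ρ hcof (w := fun i : Fin 0 => algebraMap (𝓞 K) K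
          (((fun i : Fin 0 => i.elim0 : Fin 0 → (𝓞 K)ˣ) i : (𝓞 K)ˣ) : 𝓞 K))
        (g := fun j => algebraMap (𝓞 K) K (W j)) (fun i => i.elim0)
        (fun j => RingOfIntegers.coe_ne_zero_iff.mpr (hW0 j)) (fun i => i.elim0)
        (fun j => norm_of_famCheck₂ hθ h3 hF) (fun i => i.elim0)
        (fun j => sign_iff_of_famCheck₂ hθ ρ hlo hhi hF (hfam j)) x y hxy T U hsq
    have h2 := valRow_sound hFrel hθQ (fc.W₁₁ hθ h3 hF hpr) (by rw [hderiv]; exact hDW₁₁) hW0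
      (r := fun j => bitRow₂ fc (fm.get j) 1) (fun j => by
        show ((!decide ((2 : ℤ) ∣ famL₁₁ (fm.get j))) = true ↔ _)
        rw [show algebraMap (𝓞 K) K (W j) = ((W j : 𝓞 K) : K) from rfl,
          log_W₁₁_of_famCheck₂ hθ h3 hF hpr (hfam j)]; simp) x y hxy T U hsq
    have h3' := valRow_sound hFrel hθQ (fc.W₁₂ hθ h3 hF hpr) (by rw [hderiv]; exact hDW₁₂) hW0
      (r := fun j => bitRow₂ fc (fm.get j) 2) (fun j => by
        show ((!decide ((2 : ℤ) ∣ famL₁₂ (fm.get j))) = true ↔ _)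
        rw [show algebraMap (𝓞 K) K (W j) = ((W j : 𝓞 K) : K) from rfl,
          log_W₁₂_of_famCheck₂ hθ h3 hF hpr (hfam j)]; simp) x y hxy T U hsq
    have h4' := valRow_sound hFrel hθQ (fc.W₂₁ hθ h3 hF hpr) (by rw [hderiv]; exact hDW₂₁) hW0
      (r := fun j => bitRow₂ fc (fm.get j) 3) (fun j => by
        show ((!decide ((2 : ℤ) ∣ famL₂₁ (fm.get j))) = true ↔ _)
        rw [show algebraMap (𝓞 K) K (W j) = ((W j : 𝓞 K) : K) from rfl,
          log_W₂₁_of_famCheck₂ hθ h3 hF hpr (hfam j)]; simp) x y hxy T U hsq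
    have h5' := valRow_sound hFrel hθQ (fc.W₂₂ hθ h3 hF hpr) (by rw [hderiv]; exact hDW₂₂) hW0
      (r := fun j => bitRow₂ fc (fm.get j) 4) (fun j => by
        show ((!decide ((2 : ℤ) ∣ famL₂₂ (fm.get j))) = true ↔ _)
        rw [show algebraMap (𝓞 K) K (W j) = ((W j : 𝓞 K) : K) from rfl,
          log_W₂₂_of_famCheck₂ hθ h3 hF hpr (hfam j)]; simp) x y hxy T U hsq
    simp only [adm₂, Bool.and_eq_true]
    exact ⟨⟨⟨⟨admStdQ_of_admStd hQ h1, h2⟩, h3'⟩, h4'⟩, h5'⟩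
  exact mordellWeilRank_le_of_coverSet_cl (A := cc.A) (B := cc.B) (C := cc.C)
    (⟨0, cc.A, 0, cc.B, cc.C⟩ : WeierstrassCurve ℚ) rfl rfl rfl rfl rfl hirrF' haev h3 hM0 hgen hDM hW0 hspan
    (Wu := fun i : Fin 0 => i.elim0) (adm := adm₂ fc cc) hadm0 hadm (s' := 2) hcount
/-- **`rank E(ℚ) = 2`** from checked two-prime field and curve records and the tree's lower bound.
[cite: CremonaAlgorithms1997, §3.6] -/
theorem rank_eq_two_of_check_cl₂ (fc : ClFieldCertQ2) (hθ : aeval θ (MonicCubic.poly fc.a fc.b fc.c) = 0)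
    (h3 : finrank ℚ K = 3) (hF : fc.check = true) (hpr : fc.primeList.Forall Nat.Prime) (cc : ClCurveCertQ2)
    (hc : check₂ fc cc = true)
    (hlow : 2 ≤ (((⟨0, cc.A, 0, cc.B, cc.C⟩ : WeierstrassCurve ℤ)).map (Int.castRingHom ℚ)).mordellWeilRank) :
    (((⟨0, cc.A, 0, cc.B, cc.C⟩ : WeierstrassCurve ℤ)).map (Int.castRingHom ℚ)).mordellWeilRank = 2 := by
  have hE : ((⟨0, cc.A, 0, cc.B, cc.C⟩ : WeierstrassCurve ℤ)).map (Int.castRingHom ℚ) =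
      (⟨0, cc.A, 0, cc.B, cc.C⟩ : WeierstrassCurve ℚ) := by
    ext <;> simp [WeierstrassCurve.map]
  refine le_antisymm ?_ hlow
  rw [hE]
  exact rank_le_two_of_check_cl₂ fc hθ h3 hF hpr cc hc
end Sound

/-! ## `K`-free wrappers over the model `CubicField a b c` (the shape of every sharded per-curve declaration) -/
/-- **`rank E(ℚ) = 2` from the two records** (model `(0, A, 0, B, C)`):
`rank_eq_two_of_certs₂ <field> ⟨curve⟩ (by decide +kernel) (by norm_num [ClFieldCertQ2.primeList]) (by decide +kernel) <lower bound>`.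
[cite: Cassels1991LecturesEllipticCurves, §15] [cite: CremonaAlgorithms1997, §3.6] -/
theorem rank_eq_two_of_certs₂ (fc : ClFieldCertQ2) (cc : ClCurveCertQ2) (hF : fc.check = true)
    (hpr : fc.primeList.Forall Nat.Prime) (hc : check₂ fc cc = true)
    (hlow : 2 ≤ (((⟨0, cc.A, 0, cc.B, cc.C⟩ : WeierstrassCurve ℤ)).map (Int.castRingHom ℚ)).mordellWeilRank) :
    (((⟨0, cc.A, 0, cc.B, cc.C⟩ : WeierstrassCurve ℤ)).map (Int.castRingHom ℚ)).mordellWeilRank = 2 := by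
  haveI : Fact (Irreducible (MonicCubic.polyQ fc.a fc.b fc.c)) := ⟨fc.irreducible_of_check hF⟩
  exact rank_eq_two_of_check_cl₂ (K := CubicField fc.a fc.b fc.c) fc (CubicField.aeval_root fc.a fc.b fc.c)
    (CubicField.finrank_eq fc.a fc.b fc.c) hF hpr cc hc hlow
/-- **`rank E(ℚ) = 2` for the ORIGINAL model** `(a₁, a₂, a₃, a₄, a₆)` when the records certify its
completed-square model `(0, a₁² + 4a₂, 0, 8(a₁a₃ + 2a₄), 16(a₃² + 4a₆))`. [cite: CremonaAlgorithms1997, §3.6] -/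
theorem rank_eq_two_of_certs_complSq₂ (fc : ClFieldCertQ2) (cc : ClCurveCertQ2) (hF : fc.check = true)
    (hpr : fc.primeList.Forall Nat.Prime) (hc : check₂ fc cc = true) (a₁ a₂ a₃ a₄ a₆ : ℤ)
    (hABC : cc.A = a₁ ^ 2 + 4 * a₂ ∧ cc.B = 8 * (a₁ * a₃ + 2 * a₄) ∧ cc.C = 16 * (a₃ ^ 2 + 4 * a₆))
    (hlow : 2 ≤ (((⟨a₁, a₂, a₃, a₄, a₆⟩ : WeierstrassCurve ℤ)).map (Int.castRingHom ℚ)).mordellWeilRank) :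
    (((⟨a₁, a₂, a₃, a₄, a₆⟩ : WeierstrassCurve ℤ)).map (Int.castRingHom ℚ)).mordellWeilRank = 2 := by
  obtain ⟨hA, hB, hC⟩ := hABC
  have hV : ((⟨0, cc.A, 0, cc.B, cc.C⟩ : WeierstrassCurve ℤ)).map (Int.castRingHom ℚ) =
      (⟨Units.mk0 (1 / 2 : ℚ) (by norm_num), 0, -(a₁ : ℚ) / 2, -(a₃ : ℚ) / 2⟩ :
        WeierstrassCurve.VariableChange ℚ) •
        (((⟨a₁, a₂, a₃, a₄, a₆⟩ : WeierstrassCurve ℤ)).map (Int.castRingHom ℚ)) := by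
    ext <;> simp only [WeierstrassCurve.map_a₁, WeierstrassCurve.map_a₂, WeierstrassCurve.map_a₃,
      WeierstrassCurve.map_a₄, WeierstrassCurve.map_a₆, WeierstrassCurve.variableChange_a₁,
      WeierstrassCurve.variableChange_a₂, WeierstrassCurve.variableChange_a₃,
      WeierstrassCurve.variableChange_a₄, WeierstrassCurve.variableChange_a₆, Units.val_inv_eq_inv_val,
      Units.val_mk0, hA, hB, hC, eq_intCast, Int.cast_zero] <;> push_cast <;> ring
  have hr : (((⟨0, cc.A, 0, cc.B, cc.C⟩ : WeierstrassCurve ℤ)).map (Int.castRingHom ℚ)).mordellWeilRank =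
      (((⟨a₁, a₂, a₃, a₄, a₆⟩ : WeierstrassCurve ℤ)).map (Int.castRingHom ℚ)).mordellWeilRank := by
    rw [hV]; exact WeierstrassCurve.mordellWeilRank_variableChange_holds _ _
  rw [← hr] at hlow ⊢
  exact rank_eq_two_of_certs₂ fc cc hF hpr hc hlow
end Summit.BirchSwinnertonDyer.BirchSwinnertonDyer.Rank2Observatory.TwoDescCl

end
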